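import Summits.BirchSwinnertonDyer.BirchSwinnertonDyer.Theorems.CyclotomicUntwistUntwistedDistributionRelation
import HarnessLib

/-!
# The Mazur–Tate–Teitelbaum "one allowable root" system of the untwist, in the rational plus symbols of
# `f`: ADDITIVITY and the "only the fittest term survives" INTERPOLATION are formal consequences of
# `U_p(f ⊗ η̄) = 0` and of character orthogonality — the order-`½` GROWTH is the one non-formal input of F1

Cell `pub/bsd-wall` (D-0145 line `route-BirchSwinnertonDyer-CyclotomicUntwist`), seat `bsd-line-cycu-p1`
(prover seat 1/3, K1 base), helper toward crux K1 `PSRankOneLowerHalfAtThree`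
(stmt-BirchSwinnertonDyer-21580). THEOREMS ONLY (no definition, no named fact, no `sorry`); BSD is not
proved by this file and no crux is.

THE CANDIDATE (hypothesis-parametrised, so that no definition is introduced). With the untwisted symbol of
level `j`, `S_j(y) = ∑_{b mod p^c} η(b) [y/p^j + b/p^c]⁺_f` (`y ∈ ℤ/p^j`; the `h = f ⊗ η̄` symbol in
`f`-currency, as in D1's `untwistSymbolSum`), the untwist `g = ∑_{k≥0} α^k h(p^k·)` (`g = h + α g(p·)`,
`U_p g = α g ⟺ U_p h = 0`) has `{∞, x/p^M}_g = ∑_{k<M} (α/p)^k {∞, x/p^{M−k}}_h + (α/p)^M (1 − α/p)⁻¹ {∞,0}_h`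
(archimedean geometric tail), so the Mazur–Tate–Teitelbaum ball values `α^{−M}{∞, x/p^M}_g` on `ℤ_p` are the
FINITE `f`-symbol expressions

  `ν_M(x) = ∑_{j=1}^{M} α^{−j} p^{j−M} S_j(x mod p^j) + p^{−M} (1 − α/p)⁻¹ S_0`     (MTT §I.10, Bellaïche §6.7.2).

For ANY functions `S`, `ν` satisfying these two displayed formulas (`hS`, `hν`) this file PROVES:
* §2 `fibreSum_nu_eq` — **ADDITIVITY** `∑_{x' ≡ x (p^M)} ν_{M+1}(x') = ν_M(x)` (η PRIMITIVE mod `p^c`, `c ≥ 1`):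
  the level-`j ≤ M` terms are constant on the fibre and pick up the factor `p`, the level-`M+1` term sums to
  zero over the fibre by `U_p h = 0` (`PSUntwistDistribution.untwistedFibreSum_eq_zero`), the constant term
  rescales — exactly MTT's verification that `∑ α^k V^k Φ_h` is a `U_p`-eigensymbol of eigenvalue `α`;
* §3 `sum_mulChar_nu_eq` — **INTERPOLATION ("only the fittest term survives")**: for `χ` PRIMITIVE mod `pⁿ`,
  `n ≥ 1`: `∑_{x mod pⁿ} χ(x) ν_n(x) = α^{−n} · untwistSymbolSum p f η χ` — the terms of level `j < n` die
  because a primitive character sums to zero on every fibre of `ℤ/pⁿ → ℤ/p^j` (`sum_fibre_mulChar_eq_zero`),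
  the constant term because `∑ χ = 0`; the level-`n` term IS D1's double symbol sum with multiplier
  `e_n(α) = α^{−n}` (`untwistMultiplier`);
* §4 `mass_units_eq` — the trivial-character clause: `ν_1(ℤ_p) − ν_1(pℤ_p) = (1 − α⁻¹)(1 − α/p)⁻¹ · S_0 =
  e_0(α) · untwistSymbolSum p f η 𝟙` (D1's `untwistMultiplier p α 0`), for `α ∉ {0, p}`.
What is NOT formal — and is therefore the whole content of the route's F1 (`∃ μ, IsUntwistedPAdicLFunction
p f η α μ`): the GROWTH clause `HasGrowthOrder p ½` for the push-forward of `η̄·ν` to `Γ`. The displayed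
formula only gives order `1` (term `j` has size `≍ p^{(n−j)/2} · p^{… }`); order `½ = v_p(α)` is the
boundedness of the untwist's OWN modular symbols `{∞, r}_g/Ω` (Manin–Drinfeld for `g` on `Γ₁(p^c M)` and the
period relation to `Ω⁺_f`), a statement about an archimedean-convergent infinite combination of `f`-symbols
that no finite symbol identity sees. The push-forward to `Γ` (Teichmüller classes, as in the tree's
`PAdicLFunctionInterpolationProofs`) is routine bookkeeping on top of §2–§4 and is not done here.

References: [cite: MazurTateTeitelbaum1986Invent, §I.10–§I.11 and §I.14 (case p ∣ N)];
[cite: Bellaiche2021, §6.7.2 (6.7.8) and §6.7.3]; [folklore] (character orthogonality on fibres).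
-/

noncomputable section

open scoped MatrixGroups

open CongruenceSubgroup DirichletCharacter Literature.NumberTheory.EllipticCurves
  Literature.NumberTheory.EllipticCurves.ModularForms Literature.NumberTheory.IwasawaTheory
  Summit.BirchSwinnertonDyer.BirchSwinnertonDyer.Theorems.PSUntwisting
  Summit.BirchSwinnertonDyer.BirchSwinnertonDyer.Theorems.PSPrimePowerGauss
  Summit.BirchSwinnertonDyer.BirchSwinnertonDyer.Theorems.PSUntwistDistribution

-- single-conjunct summit: `Summit.BirchSwinnertonDyer.BirchSwinnertonDyer.…` repeats the name by design
set_option linter.dupNamespace false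
set_option autoImplicit false

namespace Summit.BirchSwinnertonDyer.BirchSwinnertonDyer.Theorems.PSUntwistedSystem

variable {p : ℕ} [Fact p.Prime]

/-! ### §1 Fibres of `ℤ/p^{M+1} → ℤ/p^M` and primitive characters on fibres -/

section Fibre

/-- The canonical lift of a fibre point: for `x ∈ ℤ/p^M` and `j ∈ ℤ/p`, the natural number
`x̃ + p^M j̃ < p^{M+1}` is its own residue. [folklore] -/
theorem val_fibrePoint {M : ℕ} (x : ZMod (p ^ M)) (j : ZMod (p ^ 1)) :
    (((x.val + p ^ M * j.val : ℕ) : ZMod (p ^ (M + 1)))).val = x.val + p ^ M * j.val := by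
  haveI : NeZero (p ^ M) := ⟨pow_ne_zero _ (Fact.out : p.Prime).ne_zero⟩
  haveI : NeZero (p ^ 1) := ⟨pow_ne_zero _ (Fact.out : p.Prime).ne_zero⟩
  apply ZMod.val_natCast_of_lt
  have hx := ZMod.val_lt x
  have hj : j.val < p := lt_of_lt_of_eq (ZMod.val_lt j) (pow_one p)
  calc x.val + p ^ M * j.val < p ^ M + p ^ M * j.val := by omega
    _ = p ^ M * (j.val + 1) := by ring
    _ ≤ p ^ M * p := Nat.mul_le_mul_left _ hj
    _ = p ^ (M + 1) := (pow_succ p M).symm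

omit [Fact p.Prime] in
/-- Reducing the fibre point to a level `i + 1 ≤ M` forgets `j`: `(x̃ + p^M j̃ : ℤ/p^{i+1}) = (x̃ : ℤ/p^{i+1})`.
[folklore] -/
theorem natCast_fibrePoint_of_le {M i : ℕ} (hi : i + 1 ≤ M) (x : ZMod (p ^ M)) (j : ZMod (p ^ 1)) :
    ((x.val + p ^ M * j.val : ℕ) : ZMod (p ^ (i + 1))) = ((x.val : ℕ) : ZMod (p ^ (i + 1))) := by
  push_cast
  rw [show ((p : ZMod (p ^ (i + 1))) ^ M) = ((p ^ M : ℕ) : ZMod (p ^ (i + 1))) by push_cast; rfl,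
    (ZMod.natCast_eq_zero_iff _ _).mpr (pow_dvd_pow p hi), zero_mul, add_zero]

/-- **A primitive character sums to zero on every fibre of `ℤ/pⁿ → ℤ/p^d`, `d < n`.** (Multiply the fibre
by a unit `u ≡ 1 (mod p^{n−1})` with `χ(u) ≠ 1`.) [folklore] -/
theorem sum_fibre_mulChar_eq_zero {n : ℕ} (χ : DirichletCharacter ℂ_[p] (p ^ n)) (hχ : χ.IsPrimitive)
    {d : ℕ} (hd : d < n) (y : ZMod (p ^ d)) :
    ∑ x ∈ Finset.univ.filter (fun x : ZMod (p ^ n) ↦ ZMod.castHom (pow_dvd_pow p hd.le) (ZMod (p ^ d)) x = y),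
      χ x = 0 := by
  classical
  have hn : 0 < n := by omega
  obtain ⟨u, hu, hne⟩ := exists_unitsMap_eq_one_apply_ne_one χ hn hχ
  obtain ⟨q, hq⟩ := exists_eq_one_add_of_unitsMap_eq_one (Nat.sub_le n 1) hu
  set π := ZMod.castHom (pow_dvd_pow p hd.le) (ZMod (p ^ d)) with hπ
  have hπu : π (u : ZMod (p ^ n)) = 1 := by
    rw [hq, map_add, map_one, map_mul, map_natCast, (ZMod.natCast_eq_zero_iff _ _).mpr
      (pow_dvd_pow p (by omega : d ≤ n - 1)), zero_mul, add_zero]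
  have hπuinv : π ((u⁻¹ : (ZMod (p ^ n))ˣ) : ZMod (p ^ n)) = 1 := by
    have h : π ((u⁻¹ : (ZMod (p ^ n))ˣ) : ZMod (p ^ n)) * π (u : ZMod (p ^ n)) = 1 := by
      rw [← map_mul, Units.inv_mul, map_one]
    rwa [hπu, mul_one] at h
  set F := Finset.univ.filter (fun x : ZMod (p ^ n) ↦ π x = y) with hF
  have hmem : ∀ {x : ZMod (p ^ n)} (v : (ZMod (p ^ n))ˣ), π (v : ZMod (p ^ n)) = 1 →
      (x ∈ F ↔ (v : ZMod (p ^ n)) * x ∈ F) := by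
    intro x v hv
    simp only [hF, Finset.mem_filter, Finset.mem_univ, true_and, map_mul, hv, one_mul]
  have hsum : ∑ x ∈ F, χ x = χ u * ∑ x ∈ F, χ x := by
    rw [Finset.mul_sum]
    refine (Finset.sum_nbij' (fun x ↦ (u : ZMod (p ^ n)) * x)
      (fun x ↦ ((u⁻¹ : (ZMod (p ^ n))ˣ) : ZMod (p ^ n)) * x) (fun x hx ↦ (hmem u hπu).mp hx)
      (fun x hx ↦ (hmem u⁻¹ hπuinv).mp hx) (fun x _ ↦ ?_) (fun x _ ↦ ?_) (fun x _ ↦ ?_)).symm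
    · rw [← mul_assoc, Units.inv_mul, one_mul]
    · rw [← mul_assoc, Units.mul_inv, one_mul]
    · rw [map_mul]
  have h0 : (χ u - 1) * ∑ x ∈ F, χ x = 0 := by linear_combination -hsum
  exact (mul_eq_zero.mp h0).resolve_left (sub_ne_zero.mpr hne)

/-- `∑_{x mod pⁿ} χ(x) · G(x mod p^d) = 0` for `χ` primitive mod `pⁿ`, `d < n`, and any `G`. [folklore] -/
theorem sum_mulChar_mul_comp_castHom_eq_zero {n : ℕ} (χ : DirichletCharacter ℂ_[p] (p ^ n))
    (hχ : χ.IsPrimitive) {d : ℕ} (hd : d < n) (G : ZMod (p ^ d) → ℂ_[p]) :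
    ∑ x : ZMod (p ^ n), χ x * G (ZMod.castHom (pow_dvd_pow p hd.le) (ZMod (p ^ d)) x) = 0 := by
  classical
  set π := ZMod.castHom (pow_dvd_pow p hd.le) (ZMod (p ^ d)) with hπ
  rw [← Finset.sum_fiberwise_of_maps_to (s := Finset.univ) (t := Finset.univ) (g := π)
    (fun x _ ↦ Finset.mem_univ (π x))]
  refine Finset.sum_eq_zero fun y _ ↦ ?_
  have h : ∑ x ∈ Finset.univ.filter (fun x : ZMod (p ^ n) ↦ π x = y), χ x * G (π x) =
      (∑ x ∈ Finset.univ.filter (fun x : ZMod (p ^ n) ↦ π x = y), χ x) * G y := by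
    rw [Finset.sum_mul]
    refine Finset.sum_congr rfl fun x hx ↦ ?_
    rw [(Finset.mem_filter.mp hx).2]
  rw [h, sum_fibre_mulChar_eq_zero χ hχ hd y, zero_mul]

/-- A primitive character of level `pⁿ`, `n ≥ 1`, is non-trivial, so `∑_x χ(x) = 0`. [folklore] -/
theorem sum_mulChar_eq_zero_of_isPrimitive {n : ℕ} (hn : 0 < n) (χ : DirichletCharacter ℂ_[p] (p ^ n))
    (hχ : χ.IsPrimitive) : ∑ x : ZMod (p ^ n), χ x = 0 := by
  haveI : NeZero (p ^ n) := ⟨pow_ne_zero _ (Fact.out : p.Prime).ne_zero⟩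
  have hp : p.Prime := Fact.out
  refine χ.sum_eq_zero_of_ne_one fun h1 ↦ ?_
  have hcond : χ.conductor = p ^ n := hχ
  rw [h1, conductor_one] at hcond
  have : 1 < p ^ n := Nat.one_lt_pow hn.ne' hp.one_lt
  omega

end Fibre

/-! ### §2 Additivity of the untwisted system -/

section System

variable {N : ℕ} [NeZero N] (f : CuspForm (Gamma0 N) 2)
variable {c : ℕ} (η : DirichletCharacter ℂ_[p] (p ^ c)) (α : ℂ_[p])
variable (S : (j : ℕ) → ZMod (p ^ j) → ℂ_[p])
variable (hS : ∀ (j : ℕ) (y : ZMod (p ^ j)), S j y = ∑ b : ZMod (p ^ c), η b *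
  algebraMap ℚ ℂ_[p] (ratPlusSymbol f ((y.val : ℚ) / (p : ℚ) ^ j + (b.val : ℚ) / (p : ℚ) ^ c)))
variable (ν : (M : ℕ) → ZMod (p ^ M) → ℂ_[p])
variable (hν : ∀ (M : ℕ) (x : ZMod (p ^ M)), ν M x =
  (∑ i ∈ Finset.range M, α⁻¹ ^ (i + 1) * ((p : ℂ_[p]) ^ (i + 1) / (p : ℂ_[p]) ^ M) *
      S (i + 1) ((x.val : ℕ) : ZMod (p ^ (i + 1)))) +
    ((p : ℂ_[p]) ^ M)⁻¹ * (1 - α / p)⁻¹ * S 0 0)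

include hS in
/-- `U_p h = 0` for the symbol function: `∑_{j mod p} S_{M+1}(x̃ + p^M j̃) = 0` (η primitive, `c ≥ 1`;
`PSUntwistDistribution.untwistedFibreSum_eq_zero`). [cite: MazurTateTeitelbaum1986Invent, §I.4 (4.2)] -/
theorem fibreSum_S_eq_zero (hc : 0 < c) (hη : η.IsPrimitive) (M : ℕ) (x : ZMod (p ^ M)) :
    ∑ j : ZMod (p ^ 1), S (M + 1) (((x.val + p ^ M * j.val : ℕ) : ZMod (p ^ (M + 1)))) = 0 := by
  have h := untwistedFibreSum_eq_zero f η hc hη M x.val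
  rw [← h]
  refine Finset.sum_congr rfl fun j _ ↦ ?_
  rw [hS, val_fibrePoint]

include hS hν in
/-- **ADDITIVITY of the untwisted system**: `∑_{j mod p} ν_{M+1}(x̃ + p^M j̃) = ν_M(x)` for `η` primitive mod
`p^c` (`c ≥ 1`) — the lower-level terms are constant on the fibre (factor `p`), the top term dies by
`U_p h = 0`, the constant term rescales. [cite: MazurTateTeitelbaum1986Invent, §I.10–§I.11]
[cite: Bellaiche2021, §6.7.2] -/
theorem fibreSum_nu_eq (hc : 0 < c) (hη : η.IsPrimitive) (M : ℕ) (x : ZMod (p ^ M)) :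
    ∑ j : ZMod (p ^ 1), ν (M + 1) (((x.val + p ^ M * j.val : ℕ) : ZMod (p ^ (M + 1)))) = ν M x := by
  haveI : NeZero (p ^ 1) := ⟨pow_ne_zero _ (Fact.out : p.Prime).ne_zero⟩
  have hp : p.Prime := Fact.out
  have hp0 : (p : ℂ_[p]) ≠ 0 := Nat.cast_ne_zero.mpr hp.ne_zero
  have hcard : (Finset.univ : Finset (ZMod (p ^ 1))).card = p := by
    rw [Finset.card_univ, ZMod.card, pow_one]
  -- expand `ν` at level `M + 1` and split off the top term `i = M`
  simp_rw [hν (M + 1), Finset.sum_range_succ, val_fibrePoint]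
  -- lower terms: independent of `j`
  have hlow : ∀ j : ZMod (p ^ 1), ∑ i ∈ Finset.range M,
      α⁻¹ ^ (i + 1) * ((p : ℂ_[p]) ^ (i + 1) / (p : ℂ_[p]) ^ (M + 1)) *
        S (i + 1) ((x.val + p ^ M * j.val : ℕ) : ZMod (p ^ (i + 1))) =
      ∑ i ∈ Finset.range M, α⁻¹ ^ (i + 1) * ((p : ℂ_[p]) ^ (i + 1) / (p : ℂ_[p]) ^ (M + 1)) *
        S (i + 1) ((x.val : ℕ) : ZMod (p ^ (i + 1))) := by
    intro j
    refine Finset.sum_congr rfl fun i hi ↦ ?_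
    rw [natCast_fibrePoint_of_le (Nat.succ_le_of_lt (Finset.mem_range.mp hi))]
  -- top term: `(x̃ + p^M j̃ : ℤ/p^{M+1})` is the fibre point itself
  have htop : ∀ j : ZMod (p ^ 1), ((x.val + p ^ M * j.val : ℕ) : ZMod (p ^ (M + 1))) =
      ((((x.val + p ^ M * j.val : ℕ) : ZMod (p ^ (M + 1)))).val : ZMod (p ^ (M + 1))) := by
    intro j; rw [val_fibrePoint]
  simp_rw [hlow]
  rw [Finset.sum_add_distrib, Finset.sum_add_distrib, Finset.sum_const, Finset.sum_const, hcard,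
    ← Finset.mul_sum]
  have htopsum : ∑ j : ZMod (p ^ 1), S (M + 1) ((x.val + p ^ M * j.val : ℕ) : ZMod (p ^ (M + 1))) = 0 :=
    fibreSum_S_eq_zero f η S hS hc hη M x
  rw [htopsum, mul_zero, add_zero, hν M x]
  -- the scalars: `p • (c/p^{M+1}) = c/p^M`
  rw [nsmul_eq_mul, nsmul_eq_mul, Finset.mul_sum]
  congr 1
  · refine Finset.sum_congr rfl fun i _ ↦ ?_
    rw [pow_succ]
    field_simp
    ring
  · rw [pow_succ]
    field_simp

/-! ### §3 Interpolation: only the fittest term survives -/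

include hν in
omit [NeZero N] in
/-- **`∑_{x mod pⁿ} χ(x) ν_n(x) = α^{−n} · untwistSymbolSum p f η χ`** for `χ` PRIMITIVE mod `pⁿ`, `n ≥ 1`
(no hypothesis on `η`). The terms of level `j < n` and the constant term vanish by orthogonality
(`sum_mulChar_mul_comp_castHom_eq_zero`, `∑ χ = 0`); the top term is D1's double symbol sum.
[cite: MazurTateTeitelbaum1986Invent, §I.14 (case p ∣ N)] [cite: Bellaiche2021, §6.7.3 ("only the fittest term survives")] -/
theorem sum_mulChar_nu_eq (hS : ∀ (j : ℕ) (y : ZMod (p ^ j)), S j y = ∑ b : ZMod (p ^ c), η b *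
      algebraMap ℚ ℂ_[p] (ratPlusSymbol f ((y.val : ℚ) / (p : ℚ) ^ j + (b.val : ℚ) / (p : ℚ) ^ c)))
    {n : ℕ} (hn : 0 < n) (χ : DirichletCharacter ℂ_[p] (p ^ n))
    (hχ : χ.IsPrimitive) :
    ∑ x : ZMod (p ^ n), χ x * ν n x = α⁻¹ ^ n * untwistSymbolSum p f η χ := by
  haveI : NeZero (p ^ n) := ⟨pow_ne_zero _ (Fact.out : p.Prime).ne_zero⟩
  have hp : p.Prime := Fact.out
  have hp0 : (p : ℂ_[p]) ≠ 0 := Nat.cast_ne_zero.mpr hp.ne_zero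
  obtain ⟨m, rfl⟩ : ∃ m, n = m + 1 := ⟨n - 1, by omega⟩
  simp_rw [hν (m + 1), Finset.sum_range_succ, mul_add, Finset.sum_add_distrib]
  -- constant term
  have hconst : ∑ x : ZMod (p ^ (m + 1)),
      χ x * (((p : ℂ_[p]) ^ (m + 1))⁻¹ * (1 - α / p)⁻¹ * S 0 0) = 0 := by
    rw [← Finset.sum_mul, sum_mulChar_eq_zero_of_isPrimitive hn χ hχ, zero_mul]
  -- lower terms
  have hlow : ∑ x : ZMod (p ^ (m + 1)), χ x * ∑ i ∈ Finset.range m,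
      α⁻¹ ^ (i + 1) * ((p : ℂ_[p]) ^ (i + 1) / (p : ℂ_[p]) ^ (m + 1)) *
        S (i + 1) ((x.val : ℕ) : ZMod (p ^ (i + 1))) = 0 := by
    simp_rw [Finset.mul_sum]
    rw [Finset.sum_comm]
    refine Finset.sum_eq_zero fun i hi ↦ ?_
    have hi' : i + 1 < m + 1 := by have := Finset.mem_range.mp hi; omega
    have h := sum_mulChar_mul_comp_castHom_eq_zero χ hχ hi'
      (fun y ↦ α⁻¹ ^ (i + 1) * ((p : ℂ_[p]) ^ (i + 1) / (p : ℂ_[p]) ^ (m + 1)) * S (i + 1) y)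
    rw [← h]
    refine Finset.sum_congr rfl fun x _ ↦ ?_
    rw [ZMod.castHom_apply, ← ZMod.natCast_val]
  -- top term
  have htop : ∑ x : ZMod (p ^ (m + 1)),
      χ x * (α⁻¹ ^ (m + 1) * ((p : ℂ_[p]) ^ (m + 1) / (p : ℂ_[p]) ^ (m + 1)) *
        S (m + 1) ((x.val : ℕ) : ZMod (p ^ (m + 1)))) = α⁻¹ ^ (m + 1) * untwistSymbolSum p f η χ := by
    rw [div_self (pow_ne_zero _ hp0), mul_one]
    unfold untwistSymbolSum
    rw [Finset.mul_sum]
    refine Finset.sum_congr rfl fun x _ ↦ ?_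
    rw [ZMod.natCast_zmod_val, hS, Finset.mul_sum, Finset.mul_sum, Finset.mul_sum]
    exact Finset.sum_congr rfl fun b _ ↦ by ring
  rw [hlow, htop, hconst, zero_add, add_zero]

/-! ### §4 The trivial-character clause: `ν(ℤ_p^×) = e_0(α) · S_0` -/

include hS in
omit [NeZero N] in
/-- `S_1(0) = S_0(0)` (both are `∑_b η(b)[b/p^c]⁺`). [folklore] -/
theorem S_one_zero_eq : S 1 0 = S 0 0 := by
  rw [hS, hS]
  simp

include hS hν in
/-- **`ν_1(ℤ_p) − ν_1(pℤ_p) = (1 − α⁻¹)(1 − α/p)⁻¹ · S_0`** — the mass of the units, i.e. D1's multiplier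
`e_0(α) = untwistMultiplier p α 0` times the level-`0` untwisted symbol sum, for `α ∉ {0, p}` and `η`
primitive mod `p^c` (`c ≥ 1`). [cite: MazurTateTeitelbaum1986Invent, §I.14 (case p ∣ N: e_p = 1 − α⁻¹)]
[cite: Bellaiche2021, Thm. 6.7.9] -/
theorem mass_units_eq (hc : 0 < c) (hη : η.IsPrimitive) (hα : α ≠ 0) (hαp : α ≠ p) :
    ∑ x : ZMod (p ^ 1), ν 1 x - ν 1 0 = (1 - α⁻¹) * (1 - α / p)⁻¹ * S 0 0 := by
  haveI : NeZero (p ^ 1) := ⟨pow_ne_zero _ (Fact.out : p.Prime).ne_zero⟩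
  haveI : NeZero (p ^ 0) := ⟨by simp⟩
  have hp : p.Prime := Fact.out
  have hp0 : (p : ℂ_[p]) ≠ 0 := Nat.cast_ne_zero.mpr hp.ne_zero
  have h1p : (1 - α / p) ≠ 0 := by
    intro h
    exact hαp ((div_eq_one_iff_eq hp0).mp (sub_eq_zero.mp h).symm)
  -- total mass at level 1 = `ν_0(0)` by additivity at `M = 0`
  have htot : ∑ x : ZMod (p ^ 1), ν 1 x = ν 0 (0 : ZMod (p ^ 0)) := by
    rw [← fibreSum_nu_eq f η α S hS ν hν hc hη 0 (0 : ZMod (p ^ 0))]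
    refine Finset.sum_congr rfl fun j _ ↦ ?_
    congr 1
    have hj : ((0 : ZMod (p ^ 0)).val + p ^ 0 * j.val : ℕ) = j.val := by
      rw [ZMod.val_zero, pow_zero, one_mul, zero_add]
    rw [hj, ZMod.natCast_zmod_val]
  rw [htot, hν 0, hν 1, Finset.sum_range_zero, zero_add, Finset.sum_range_one]
  have h10 : S (0 + 1) ((((0 : ZMod (p ^ (0 + 1))).val : ℕ) : ZMod (p ^ (0 + 1)))) = S 0 0 := by
    rw [ZMod.val_zero, Nat.cast_zero]
    exact S_one_zero_eq f η S hS
  rw [h10]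
  simp only [pow_zero, inv_one, one_mul, zero_add, pow_one, div_self hp0, mul_one]
  field_simp
  ring

end System

end Summit.BirchSwinnertonDyer.BirchSwinnertonDyer.Theorems.PSUntwistedSystem
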